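import Summits.CriticalPhenomena.SAWScalingLimit.Theses.SAWRenewalTightness
import Literature.Probability.RandomPlanarGeometry.SAWRenewalBound

/-!
# Line `subcritical-renewal-floor` — skeleton for the crux `SAWRenewalTightness.TubeLowerBound`
(crux item stmt-CriticalPhenomena-4730, rank 4 of route `route-CriticalPhenomena-SAWRenewalTightness`, shared as
support by `SAWEdgeOfPositiveType`; crux-plan round 1; idea card `Ideas/subcritical-renewal-floor.md`, triage r1-1: pass
with objections O4, O1′, O5 — answered below)

Crux (FIXED, by name): `TubeLowerBound` — there are `C` and `c > 0` such that for all `u v ∈ ℤ²` and `ℓ ≥ 1` with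
`|u − v| ≤ ℓ` some partial sum of the `x_c`-mass of self-avoiding walks `u → v` whose vertices stay within `ℓ/10 + 2`
of the segment `[u, v]` is `≥ c ℓ^{−C}`.

## The line (5 registered stubs, glued by `TubeLowerBound_of`)

Approach `x_c` FROM BELOW (termwise `z^n ≤ x_c^n`, lossless for floors) and run Kesten's TILTED renewal chain of
irreducible bridges (Madras–Slade 1993 §4.2: `p_L = A_z(L) e^{m(z)L}` is a probability law, (4.2.11)+(4.2.15); its
atom `p_1 ≥ z`; pieces are i.i.d., (4.2.27)–(4.2.28)) on a MULTI-SCALE ladder of fugacities `z_k ↑ x_c` with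
`ξ(z_k) = D_k / r` at remaining span `D_k`, `D_{k+1}/D_k ∈ [1/64, 1/32]` (triage O4: no sub-`ξ` window floors are
needed; every level is a law-of-large-numbers statement over `≍ r` correlation lengths at tilt cost `e^{-2r} = O(1)`,
and `log_{32} s` levels give a polynomial). The physical input is exactly a pair of UNIFORM NORMALISED MOMENT BOUNDS
for the tilted irreducible-bridge law as `z ↑ x_c` (single-scale hyperscaling; no `χ`, no `ν`):

* `stub_kestenTilt` (S1, KNOWN, M–L) — for every small tilt rate `m` there is a fugacity `z ∈ [x_c/2, x_c]` at which the
  tilted irreducible-bridge weights `z^{|w|} e^{m·span(w)}` sum to exactly `1` (MS Prop. 4.1.1(b), Cor. 4.1.15–16,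
  Thm. 4.1.14, (4.2.12)–(4.2.15); the `z = x_c`, `m = 0` shadow is the route support `KestenIdentity`, stmt-4733).
* `stub_spanHyperscaling` (S2, OPEN, HARDEST) — longitudinal: `E[X²] ≤ (C/m)·E[X]` for the tilted span law, uniformly
  as `m ↓ 0`; equivalently a QUANTITATIVE Madras–Slade Thm 4.2.4 (`m_A(z) − m(z) ≳ m(z)`: renewal columns have positive
  density per correlation length). Feeds Lorden's overshoot bound: windows of width `≍ ξ` are hit with probability `≥ 1/2`.
* `stub_transversalHyperscaling` (S3, OPEN) — transversal: `E[min(Y², ξ²)] ≥ (c/m)·E[X]` (pieces of span `≍ ξ` do move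
  sideways by `≍ ξ`), `E[R²] ≤ (C/m)·E[X]` and `E[R^{2+η}] ≤ C ξ^{1+η} E[X]` for the transversal excursion radius `R ≥ |Y|`
  of a piece (isotropy at scale `ξ`; the `(2+η)`-moment controls the largest piece and the end taper) — triage O1′ asked
  for the two-sided transversal input as a separate stub; this is it, with no third/fourth-moment or CLT hypothesis:
  the piecewise REFLECTION SYMMETRY `y ↦ −y` of irreducible bridges makes the transversal motion a Rademacher sum given
  the unsigned pieces, and Khintchine/Berry–Esseen/Lévy inequalities for Rademacher sums are distribution-free.
* `stub_renewalEngine` (S4, XL, classical probability + Kesten combinatorics) — S1 → S2 → S3 → `ConeBridgeFloor`: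
  a polynomial floor for the `x_c`-mass of e₁-BRIDGES `0 → (s, t)` (exact endpoint, `|t| ≤ κ s`) confined to the tube
  `|y − (t/s)x| ≤ κ s/4 + 1` around their chord and to the END CONE `4|y − t| ≤ s − x` (taper: the walk meets its last
  column only at its tip). Tools: Lorden windows (S2); sign-steering in `J` blocks per level with Berry–Esseen windows
  and Chebyshev (S3); Lévy/Kolmogorov maximal inequalities (tube); `(2+η)`-Markov for the largest piece and the cone;
  unit atoms `(→)`, `(→,↑)` at the last `O(1)` scale (exact hit); injectivity by unique Kesten factorisation + first
  passage (in tree: `SAW.eq_of_append_eq`). Milestone (triage O5): `SpanRenewalFloor` (transversally free, S1+S2 only)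
  — proved below to FOLLOW from `ConeBridgeFloor`; provers should land it first as a `--supports` lemma.
* `stub_staircaseAssembly` (S5, L, lattice geometry) — `ConeBridgeFloor → TightTubeFloor` (the crux at its own scale
  `ℓ₀ = max(1, |u − v|)`; the passage to every `ℓ ≥ ℓ₀` is the proved composition): dihedral reduction to
  `v − u = (a, b)`, `0 ≤ b ≤ a`; a doubly-coned RUN = (co-bridge with start cone, by rotation-by-π + reversal) ++ (bridge
  with end cone); `|b| ≤ κ a`: one run; `b > κ a`: a `K = 10`-stage staircase of exact horizontal/vertical runs with
  `t = 0`; the 90° CORNERS are free — two cones with the common apex and perpendicular axes meet only at the apex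
  (`4p ≤ q ∧ 4q ≤ p ⇒ p = q = 0`), non-adjacent runs are separated by bands, the staircase deviates from `[u,v]` by
  `≤ a/(10√2) + a/1000 + 2 < ℓ/10 + 2`, and `≤ 20` runs of span `≤ ℓ` give `c^{20} ℓ^{−20C}`. This answers triage O1
  (corner cost): tapering, not slab-pinning, makes corners polynomial — the small scales of the multi-scale chain sit at
  the run's tip, so the cone costs a constant per level.
* `TubeLowerBound_of : TubeLowerBound` — the kernel-checked composition (no `sorry` of its own): S1–S3 feed S4, S5 turns
  the cone-bridge floor into the tight tube floor, and monotonicity in `ℓ` (the tube `ℓ/10 + 2` only widens, `c ℓ^{−C}`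
  only shrinks for `C ≥ 0`) gives the crux for every admissible `ℓ`.

Disproof.lean (cdisprove cycle 1, `Cruxes/TubeLowerBound/Disproof.lean`, read 2026-08-16) honoured, theorem by theorem:
`not_atFugacity_of_lt` / `atFugacity_subcritical_false` (criticality is load-bearing: the floor fails at every
`x < x_c`) — the line uses `x = x_c` at S1/S4: level `k` needs a tilted pair with `m_k = r/D_k → 0`, which forces
`z_k ↑ x_c` (at any fixed `z < x_c` only finitely many levels exist and the chain gives `e^{−m(z)ℓ}`, exactly the
refuter's decay), and the termwise comparison `z_k^n ≤ x_c^n` is where `x_c` enters the mass; `not_withoutDist` (the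
coupling `|u − v| ≤ ℓ` is load-bearing: a FIXED-width tube is a strictly subcritical strip, Kesten's pattern theorem)
— every tube here widens with the span (`κ s/4 + 1` in `ConeBridgeFloor`, `ℓ₀/10 + 2` with `ℓ₀ = max(1,|u−v|)` in
`TightTubeFloor`), and the refuter's moral "the proof must see that a strip of width `w` at `x_c` has correlation
length `≳ w`" is precisely the role of S2/S3 (the chain at remaining span `D_k` lives at correlation length
`ξ_k = D_k/r ∝` tube width); `not_withoutSlack` (the `+2` is load-bearing at lattice scale) — kept: S5's small cases
use the digital staircase (distance `< 1`) and its corner budget is `… + 3 ≤ ℓ₀/10 + 2`, `ConeBridgeFloor` carries its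
own `+1`; `constraints` / `exponent_eq_zero_of_withoutOneLe` (`0 ≤ C`, `c ≤ 1`, `1 ≤ ℓ` load-bearing) —
`TightTubeFloor` asserts `0 ≤ C` and works at `ℓ₀ ≥ 1`, and the composition only ever enlarges `ℓ`; `not_allN` — all
floors here are `∃ N` partial sums; `twoPoint_floor` (the crux contains MS's open pointwise floor for `G_{x_c}`) —
consistent: `SpanRenewalFloor`/`ConeBridgeFloor` are bridge versions of that floor and are claimed only downstream of
the open stubs S2/S3. No `Theorems/TubeLowerBound/Negative/*` lemma has landed (nothing to import); no stub is an
instance of the refuted variants `WithoutSlack`/`WithoutDist`/`AllN`/`AtFugacity x<x_c`, nor of any statement in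
`ledger negatives --problem CriticalPhenomena` (8 items, none on bridges/renewal). Further obstructions honoured by
design: self-avoidance across pieces is never assumed (pieces are bridges — free concatenation, MS (1.2.15), in tree
`Zd.bridgeCount_mul_le`, `IsSAW.append_of_bridge` — and corners are certified by the cone geometry of S5), and no stub
is a tube/window floor AT `x_c` (the "one-piece window floor" inputs of the single-`ξ` version that triage O4 objected
to are gone: S2/S3 are moment bounds for the tilted law BELOW `x_c`).
-/

noncomputable section

namespace Summit.CriticalPhenomena.SAWScalingLimit.Cruxes.TubeLowerBound.SubcriticalRenewalFloor

open scoped BigOperators Classical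
open Literature.Probability.LatticeModels
open Literature.Probability.RandomPlanarGeometry Literature.Probability.RandomPlanarGeometry.SAW
open Summit.CriticalPhenomena.SAWScalingLimit.Theses.SAWRenewalTightness

set_option linter.unusedVariables false

/-! ## Objects: Kesten's tilted irreducible-bridge law (MS 1993, (4.2.11), (4.2.27)) over the word model -/

/-- The irreducible bridges (Kesten 1963 §4; MS Def. 4.2.1) with `n` steps from the origin, as step words
(`SAW.IsIrrBridge` of `SAWWordBridges.lean`: self-avoiding, `0 < x(i) ≤ x(n)`, no break point, non-empty).
[cite: MadrasSlade1993, Definition 4.2.1] -/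
def irrWords (n : ℕ) : Finset (List Step) :=
  (sawWords n).filter fun w => IsIrrBridge w

/-- Transversal endpoint displacement `Y(w)` (second coordinate of the endpoint). [cite: MadrasSlade1993, (4.2.27)] -/
def yEnd (w : List Step) : ℤ := wEnd w 1

/-- Transversal excursion radius `R(w) = max_{0 ≤ i ≤ |w|} |y(i)|` (so `|Y(w)| ≤ R(w)`). [folklore] -/
def yRad (w : List Step) : ℕ := (Finset.range (w.length + 1)).sup fun i => (traj w i 1).natAbs

/-- The TILTED weight `z^{|w|} e^{m · span(w)}` of a word (`span = xEnd`): summed over irreducible bridges of span `L`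
this is `p_L(z) = A_z(L) e^{mL}` of MS (4.2.11) when `m = m(z)`. [cite: MadrasSlade1993, (4.2.11)] -/
def tiltWeight (z m : ℝ) (w : List Step) : ℝ := z ^ w.length * Real.exp (m * (xEnd w : ℝ))

/-- `TiltHasSum z m f S`: the tilted functional `Σ_{w irreducible bridge} f(w) z^{|w|} e^{m·span(w)}` converges (as the
series over the length `n` of the finite sums over `irrWords n`) to `S`. Stated with `HasSum` so that no `tsum` junk
value can satisfy a moment hypothesis vacuously. [cite: MadrasSlade1993, (4.2.27)] -/
def TiltHasSum (z m : ℝ) (f : List Step → ℝ) (S : ℝ) : Prop :=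
  HasSum (fun n : ℕ => ∑ w ∈ irrWords n, f w * tiltWeight z m w) S

/-- `(z, m)` is an exactly tilted (Kesten) pair: `0 < z ≤ x_c`, `m > 0`, and the tilted weights of all irreducible bridges
sum to exactly `1`, i.e. `(p_L)_L` is a probability law on spans (MS (4.2.15)); for `z < z_c` this forces `m = m(z)`
(the map `m ↦ Σ A_z(L)e^{mL}` is strictly increasing), and at `z = z_c` there is no such `m > 0`.
[cite: MadrasSlade1993, (4.2.15)] -/
def IsKestenTilt (z m : ℝ) : Prop :=
  0 < z ∧ z ≤ criticalFugacity ∧ 0 < m ∧ TiltHasSum z m (fun _ => 1) 1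

/-! ## The five statements of the line -/

/-- **S1 (known).** Every small tilt rate is realised below `x_c`, at a fugacity bounded away from `0`: there is `m₀ > 0`
such that for every `m ∈ (0, m₀]` some `z ∈ [x_c/2, x_c]` makes `(z, m)` an exactly tilted pair. Print: the bridge
mass `m(z)` is continuous and strictly decreasing on `(0, z_c)` with `m(z) → 0` as `z ↑ z_c` (MS Prop. 4.1.1(b),
Cor. 4.1.15–4.1.16, Thm. 4.1.14 `m = M̄`), and `Σ_L A_z(L) e^{m(z)L} = 1` for `z < z_c` (MS (4.2.12)–(4.2.15), via
`a_L ≥ χ(z)^{−2}`); so `m₀ = m(x_c/2)` and the intermediate value theorem. [cite: MadrasSlade1993, (4.2.15)] -/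
def KestenTiltExists : Prop :=
  ∃ m₀ : ℝ, 0 < m₀ ∧ ∀ m : ℝ, 0 < m → m ≤ m₀ →
    ∃ z : ℝ, criticalFugacity / 2 ≤ z ∧ IsKestenTilt z m

/-- **S2 (open; the load-bearing physical input).** Longitudinal single-scale hyperscaling of the tilted span law:
`E[X²] ≤ (C/m) E[X]` uniformly over exactly tilted pairs with `m ≤ m₀` (`X = span`). Since `Σ_{L ≤ 1/m} L² p_L ≤
m⁻¹ E[X]` trivially, the content is the TAIL: `p_L` decays beyond the correlation length `ξ = 1/m` at a rate `≍ m` with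
at most the natural prefactor — a quantitative form of MS Thm 4.2.4 (`m_A > m`, non-quantitative in print). Consumed
only through Lorden's inequality `E[overshoot] ≤ E[X²]/E[X] ≤ C ξ`. Why it might fail: a fat stretch of the tilted law
between `ξ` and `ξ^{1+ε}` (`m_A − m = o(m)`), i.e. renewal (break) columns rarer than one per correlation length.
[cite: MadrasSlade1993, Theorem 4.2.4] -/
def SpanHyperscaling : Prop :=
  ∃ C m₀ : ℝ, 0 < m₀ ∧ ∀ z m : ℝ, IsKestenTilt z m → m ≤ m₀ →
    ∃ S₁ S₂ : ℝ, TiltHasSum z m (fun w => (xEnd w : ℝ)) S₁ ∧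
      TiltHasSum z m (fun w => (xEnd w : ℝ) ^ 2) S₂ ∧ S₂ ≤ C / m * S₁

/-- **S3 (open).** Transversal single-scale hyperscaling of the tilted piece law, two-sided, with one `(2+η)`-moment:
with `Y` the transversal endpoint displacement and `R ≥ |Y|` the transversal excursion radius of a tilted irreducible
bridge, uniformly over exactly tilted pairs with `m ≤ m₀`:
`E[min(Y², m⁻²)] ≥ (c/m) E[X]` (lower: pieces DO move sideways at scale `ξ`),
`E[R²] ≤ (C/m) E[X]` and `E[R^{2+η}] ≤ C m^{−(1+η)} E[X]` (upper: no anomalous transversal elongation; the extra `η`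
controls the largest of `≍ r ξ^{3/4}` pieces and the end taper). Heuristic: all three sides are `≍ ξ^{5/4}` resp.
`ξ^{5/4+η}` (`p_L ≍ L^{−7/4}` below `ξ`, `|Y| ≍ R ≍ L` given span `L`). Why it might fail: tilted irreducible
bridges could be transversally degenerate (`E[Y² ∧ ξ²] = o(ξ E X)`, all sideways motion in rare pieces) or carry a
heavy transversal tail at scale `ξ` (strip at bulk `x_c` with correlation length `≫` width).
[cite: MadrasSlade1993, Theorem 4.2.6 and Lemma 4.2.7] -/
def TransversalHyperscaling : Prop :=
  ∃ C c η m₀ : ℝ, 0 < c ∧ 0 < η ∧ 0 < m₀ ∧ ∀ z m : ℝ, IsKestenTilt z m → m ≤ m₀ →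
    ∃ S₁ T V W : ℝ, TiltHasSum z m (fun w => (xEnd w : ℝ)) S₁ ∧
      TiltHasSum z m (fun w => min ((yEnd w : ℝ) ^ 2) (m⁻¹ ^ 2)) T ∧
      TiltHasSum z m (fun w => (yRad w : ℝ) ^ 2) V ∧
      TiltHasSum z m (fun w => (yRad w : ℝ) ^ (2 + η)) W ∧
      c * m⁻¹ * S₁ ≤ T ∧ V ≤ C * m⁻¹ * S₁ ∧ W ≤ C * m⁻¹ ^ (1 + η) * S₁

/-- **C⁺ = `ConeBridgeFloor`** (the Transfer statement of the line; output of S4, input of S5). There are `κ > 0`, `C`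
and `c > 0` such that for every span `s ≥ 1` and transversal target `t` with `|t| ≤ κ s`, some partial sum of the
`x_c`-mass of BRIDGES `ω : 0 → (s, t)` (vertex functions of `Zd.bridges 2 n`: `0 < x(i) ≤ x(n) = s`) all of whose
vertices satisfy the TUBE condition `|y(i) − (t/s)·x(i)| ≤ κ s/4 + 1` and the END-CONE (taper) condition
`4·|y(i) − t| ≤ s − x(i)` is at least `c s^{−C}`. Strictly more special than the crux (bridges, exact lattice endpoint,
near-axis directions only, a cone pinning the tip), and what the staircase of S5 consumes. [folklore] -/
def ConeBridgeFloor : Prop :=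
  ∃ κ C c : ℝ, 0 < κ ∧ 0 < c ∧ ∀ (s : ℕ) (t : ℤ), 1 ≤ s → |(t : ℝ)| ≤ κ * s →
    ∃ N : ℕ, c * (s : ℝ) ^ (-C) ≤ ∑ n ∈ Finset.range (N + 1),
      ∑ _ω ∈ (Zd.bridges 2 n).filter (fun ω => ω n = ![(s : ℤ), t] ∧
          ∀ i ≤ n, |((ω i 1 : ℤ) : ℝ) - (t : ℝ) / (s : ℝ) * ((ω i 0 : ℤ) : ℝ)| ≤ κ * s / 4 + 1 ∧
            4 * |ω i 1 - t| ≤ (s : ℤ) - ω i 0),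
        criticalFugacity ^ n

/-- **Milestone `SpanRenewalFloor`** (triage O5; the `T = ∞` shadow of the sibling line's `BridgeSlabAvg`): the
`x_c`-mass of bridges of span `s` from the origin is `≥ c s^{−C}` (some partial sum). Believed `≍ s^{−1/4}` (DGKLP
arXiv:1008.4321); in print only `Σ_{s ≤ Λ} ≳ log Λ` (MS (3.1.14)) and `u_s ≤ 1`. Not a registered stub: it follows from
`ConeBridgeFloor` (below) and, inside S4, from S1 + S2 alone (transversally free multi-scale chain) — the recommended
FIRST `--supports` lemma of the lead. [cite: MadrasSlade1993, §4.2 (4.2.16) and p. 92] -/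
def SpanRenewalFloor : Prop :=
  ∃ C c : ℝ, 0 < c ∧ ∀ s : ℕ, 1 ≤ s → ∃ N : ℕ, c * (s : ℝ) ^ (-C) ≤
    ∑ n ∈ Finset.range (N + 1), ∑ _ω ∈ (Zd.bridges 2 n).filter (fun ω => ω n 0 = (s : ℤ)), criticalFugacity ^ n

/-- **`TightTubeFloor`** — the crux at its own scale (output of S5): there are `C ≥ 0` and `c > 0` such that for all
`u, v ∈ ℤ²`, with `ℓ₀ := max(1, |u − v|)`, some partial sum of the `x_c`-mass of self-avoiding walks `u → v` all of
whose vertices lie within `ℓ₀/10 + 2` of the segment `[u, v]` is `≥ c ℓ₀^{−C}` (same vocabulary as the crux: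
`Zd.sawFun`, `Metric.infDist`, `segment`, `Site.toComplex`). `TubeLowerBound` quantifies over every `ℓ ≥ ℓ₀` instead;
since its tube only widens and its bound only weakens with `ℓ`, the two are equivalent for `C ≥ 0` — the easy
direction is the proved composition `TubeLowerBound_of`. [folklore] -/
def TightTubeFloor : Prop :=
  ∃ C c : ℝ, 0 ≤ C ∧ 0 < c ∧ ∀ (u v : Site 2), ∃ N : ℕ,
    c * (max 1 (dist (Site.toComplex u) (Site.toComplex v))) ^ (-C) ≤
      ∑ n ∈ Finset.range (N + 1), ∑ _ω ∈ (Zd.sawFun 2 n (v - u)).filter (fun ω => ∀ i ≤ n,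
          Metric.infDist (Site.toComplex (u + ω i)) (segment ℝ (Site.toComplex u) (Site.toComplex v)) ≤
            max 1 (dist (Site.toComplex u) (Site.toComplex v)) / 10 + 2),
        criticalFugacity ^ n

/-! ## Registered stubs (`sorry` only here) -/

/-- **S1 `stub_kestenTilt`** — `KestenTiltExists` (see the def). Known mathematics, to be proved from print over the
in-tree bridge/word infrastructure (`SAWBridges`, `SAWWordBridges`, `SAWRenewalBound`: unique decoding
`eq_of_append_eq`, `Zd.bridgeCount_le_pow`; `SAWMassNorm`: the named facts `MadrasSlade1993_prop_4_1_1b`,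
`_cor_4_1_15`, `_cor_4_1_16` may be taken as hypotheses of `--supports` lemmas but the stub itself is unconditional —
the cleanest proof works with the BRIDGE mass `M̄(z) = lim −L⁻¹ log B_z(L)` directly (Fekete), `a_L = B_z(L)e^{M̄L} ≤ 1`
(MS (4.1.12)), `a_L ≥ χ(z)^{−2}` (MS (4.1.21)–(4.1.22)) giving `Σ p_L = 1`, continuity/monotonicity of `M̄` and
`M̄ ↓ 0` as `z ↑ z_c` from `B_{z_c} = ∞` (Cor. 3.1.8, in tree for `KestenIdentity`)). Size M–L. -/
theorem stub_kestenTilt : KestenTiltExists := by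
  sorry

/-- **S2 `stub_spanHyperscaling`** — `SpanHyperscaling` (see the def): the HARDEST stub, open. Equivalent currency:
`a_L − 1/E[X] = O(e^{−θ L/ξ})` with `θ > 0` uniform (quantitative MS Thm 4.2.5), or "an `x_c`-bridge of span `L`
conditioned at scale `ξ` has a break column in every window of `C ξ` columns with probability bounded below".
Cheapest falsifier: exact enumeration / transfer matrices of irreducible bridges by (length, span) up to span `≈ 12`,
tilted at `z < x_c` with `m` solving `Σ p = 1`: the ratio `m·E[X²]/E[X]` should stay bounded as `z ↑ x_c`. -/
theorem stub_spanHyperscaling : SpanHyperscaling := by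
  sorry

/-- **S3 `stub_transversalHyperscaling`** — `TransversalHyperscaling` (see the def); open. The lower bound is what
lets the chain STEER (Berry–Esseen window for the Rademacher sum of piece displacements needs `‖d‖₂ ≍ D_k/√r`); the
upper bounds bound the transversal wander (Chebyshev/Lévy) and, through `(2+η)`, the largest piece
(`‖d‖_∞ ≤ (4Cr)^{1/(2+η)} ξ ≪ ‖d‖₂`) and the taper. Cheapest falsifier: same enumeration as S2 with the transversal
statistics `min(Y², ξ²)`, `R²`, `R^{2.5}` per unit `E[X]`. -/
theorem stub_transversalHyperscaling : TransversalHyperscaling := by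
  sorry

/-- **S4 `stub_renewalEngine`** — the multi-scale tilted renewal chain: S1 → S2 → S3 → `ConeBridgeFloor`.
Sketch (constants: `r` huge, `J = 64` blocks per level, steering depth `M = 2`, `κ = M √(J c₂ / r)`):
level `k` at remaining vector `(D_k, T_k)`, `|T_k| ≤ κ D_k`, uses the tilted pair `(z_k, m_k)` of S1 with
`m_k ∈ [r/D_k, 2r/D_k]` (tilt cost `≥ e^{−2r}` since level-`k` pieces have total span `≤ D_k` and `x_c^n ≥ z_k^n`);
(a) WINDOW: by S2 + Lorden, the first partial span sum `≥ D_k − D_k/32` is `≤ D_k − D_k/64` with probability `≥ 1/2`,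
so `D_{k+1} ∈ [D_k/64, D_k/32]`; (b) STEERING: given the unsigned pieces, flipping each irreducible piece about its
starting row preserves `IsIrrBridge`, length and span, so the transversal increments are a Rademacher sum; in each of
`J` span-blocks require the block increment within `±½σ_block` of the proportional target and the block maximum
`≤ (M+2)σ_block` (Berry–Esseen with `‖d‖_∞/‖d‖_{2,block} → 0` from S3, Lévy's inequality) — probability `≥ p₀^J`;
the level lands within `σ_k/(2√J)` of its target, which is inside level `k+1`'s reach `√J M σ_{k+1}`;
(c) TUBE and CONE: deviation from the level chord `≤ (2M+4)σ_k/√J ≤ κ D_k/4`, and at distance `δ ∈ [D_{k+1}, D_k]` from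
the tip `|y − t| ≤ κδ + (2M+4)·64δ·√(c₂/(rJ)) ≤ δ/4`; within-piece excursions `≤ (4Cr)^{1/(2+η)} ξ_k` by S3 + Markov;
(d) STOP at `D_K ≤ D_*(r, m₀)` and finish with the explicit atoms `(→,↑)^{T_K} (→)^{D_K − T_K}` (`|T_K| ≤ (D_K−1)/4`,
cost `≥ x_c^{2D_*}`); (e) INJECTIVITY: the level structure of a bridge is determined by its unique Kesten factorisation
(`SAW.eq_of_append_eq`) and first passages, so the restricted sums are lower bounds for the bridge mass; sequential
conditioning over levels gives `≥ (½ p₀^J e^{−2r}/2)^{K} x_c^{2D_*}` with `K ≤ log_{32} s + 1`. Size XL (all tools are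
classical: Lorden 1970, Khintchine/Berry–Esseen for Rademacher sums, Lévy/Kolmogorov maximal inequalities, Wald). -/
theorem stub_renewalEngine :
    KestenTiltExists → SpanHyperscaling → TransversalHyperscaling → ConeBridgeFloor := by
  sorry

/-- **S5 `stub_staircaseAssembly`** — `ConeBridgeFloor → TightTubeFloor` (the corner mechanism, lattice geometry
only; `ℓ = ℓ₀ = max(1, |u − v|)` throughout). (1) Symmetries: `sawFun`, the tube predicate
`infDist(·, [u,v]) ≤ ℓ₀/10 + 2` and `x_c^n` are invariant under the dihedral group of `ℤ²` and translations, so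
assume `u = 0`, `v = (a, b)`, `0 ≤ b ≤ a` (then `a ≤ ℓ₀ ≤ a√2`). (2) Runs: rotation by `π` plus time reversal maps
cone-bridges `0 → (s,t)` onto CO-BRIDGES `0 → (s,t)` (`0 ≤ x(i) < s` before the tip) with the START cone
`4|y(i)| ≤ x(i)`; a co-bridge followed by a bridge is self-avoiding (column separation), giving doubly-coned horizontal
runs `P → P + (s₁+s₂, t₁+t₂)` of mass `≥ c² (s₁ s₂)^{−C}`; the coordinate swap gives vertical runs. (3) `b ≤ κ a`
(and `a ≥ 2/κ`): one horizontal run. (4) `b > κ a` (and `a ≥ 4K/κ`, `K = 10`): the staircase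
`0 → (a₁,0) → (a₁,b₁) → (a₁+a₂,b₁) → …` with `Σ aⱼ = a`, `Σ bⱼ = b`, `|aⱼ − a/K|, |bⱼ − b/K| < 1`, all runs with `t = 0`;
CORNERS: at a common apex `Q` the incoming end cone `4|y − y_Q| ≤ x_Q − x` and the outgoing start cone
`4|x − x_Q| ≤ y − y_Q` share only `Q`; non-adjacent runs lie in disjoint bands (`b/K > κ a/(2K) + 2`); every vertex is
within `a/(K√2) + κ a/(4K) + 3 ≤ ℓ₀/10 + 2` of `[0, v]`; the `≤ 2K` floors multiply to `c^{2K} ℓ₀^{−2KC}`.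
(5) The finitely many `(a, b)` below the thresholds: the monotone staircase lattice path inside the tube, mass
`≥ x_c^{a+b}`. Size L (long but elementary; in-tree helpers: `Zd.concatWalk_mem_saws`, `mem_bridges`, `mem_sawFun`,
`neg_mem_sawFun`, `Site.toComplex` lemmas). -/
theorem stub_staircaseAssembly : ConeBridgeFloor → TightTubeFloor := by
  sorry

/-! ## Proved glue -/

/-- The critical fugacity is nonnegative (`x_c = 1/μ`, `μ ≥ 1`). [folklore] -/
theorem criticalFugacity_nonneg : 0 ≤ criticalFugacity := by
  have h := Zd.connectiveConstant_pos 2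
  rw [Zd.connectiveConstant_two] at h
  unfold criticalFugacity
  exact inv_nonneg.2 h.le

/-- **O5 milestone is downstream of C⁺**: `ConeBridgeFloor → SpanRenewalFloor` (take `t = 0` and forget the tube and
the cone: the filtered family only grows, termwise nonnegative weights). [folklore] -/
theorem spanRenewalFloor_of_coneBridgeFloor (h : ConeBridgeFloor) : SpanRenewalFloor := by
  obtain ⟨κ, C, c, hκ, hc, hfloor⟩ := h
  refine ⟨C, c, hc, fun s hs => ?_⟩
  have ht : |((0 : ℤ) : ℝ)| ≤ κ * s := by
    simp only [Int.cast_zero, abs_zero]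
    positivity
  obtain ⟨N, hN⟩ := hfloor s 0 hs ht
  refine ⟨N, hN.trans ?_⟩
  refine Finset.sum_le_sum fun n _ => ?_
  refine Finset.sum_le_sum_of_subset_of_nonneg ?_ fun _ _ _ => pow_nonneg criticalFugacity_nonneg n
  intro ω hω
  rw [Finset.mem_filter] at hω ⊢
  refine ⟨hω.1, ?_⟩
  have := congrFun hω.2.1 0
  simpa using this

/-! ## The composition: the five stubs give the crux BY NAME -/

/-- **`TubeLowerBound` from the line `subcritical-renewal-floor`** (kernel-checked, no `sorry` of its own): S1–S3 feed
the renewal engine S4, whose cone-bridge floor the staircase S5 turns into the tight tube floor for every direction;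
for `ℓ ≥ ℓ₀ = max(1, |u − v|)` the `ℓ₀`-tube lies inside the `ℓ`-tube and `c ℓ^{−C} ≤ c ℓ₀^{−C}` (`C ≥ 0`). -/
theorem TubeLowerBound_of : TubeLowerBound := by
  obtain ⟨C, c, hC, hc, h⟩ := stub_staircaseAssembly
    (stub_renewalEngine stub_kestenTilt stub_spanHyperscaling stub_transversalHyperscaling)
  refine ⟨C, c, hc, fun u v ℓ hℓ hd => ?_⟩
  obtain ⟨N, hN⟩ := h u v
  set ℓ₀ : ℝ := max 1 (dist (Site.toComplex u) (Site.toComplex v)) with hℓ₀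
  have hℓ₀ℓ : ℓ₀ ≤ ℓ := max_le hℓ hd
  have hℓ₀pos : 0 < ℓ₀ := lt_of_lt_of_le one_pos (le_max_left _ _)
  refine ⟨N, le_trans ?_ (hN.trans ?_)⟩
  · refine mul_le_mul_of_nonneg_left ?_ hc.le
    exact Real.rpow_le_rpow_of_nonpos hℓ₀pos hℓ₀ℓ (by linarith)
  · refine Finset.sum_le_sum fun n _ => ?_
    refine Finset.sum_le_sum_of_subset_of_nonneg ?_ fun _ _ _ => pow_nonneg criticalFugacity_nonneg n
    intro ω hω
    rw [Finset.mem_filter] at hω ⊢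
    refine ⟨hω.1, fun i hi => (hω.2 i hi).trans ?_⟩
    linarith

end Summit.CriticalPhenomena.SAWScalingLimit.Cruxes.TubeLowerBound.SubcriticalRenewalFloor

end
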